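import Literature.MathematicalPhysics.QuantumFieldTheory.Balaban1983to89.T4Continuum

/-!
# `Balaban1983to89.T4AvgSensitivity` — node O3c of the uniqueness spine (cell `pub-balaban`, T4-DAG v1 §2 O3c / §5 row
T4-O3c.E / §6 NE1a): the GAUGE-INVARIANT SENSITIVITY OF ITERATED AVERAGING, TYPED as a hypothesis shape, with the two
structural facts it rests on KERNEL-CHECKED from the tree's averaging axioms (bookkeeping; `Setup` / `T4Continuum` vocabulary)

HONEST FRAMING.  The cell's T4 target is the existence and uniqueness of the continuum limit of Bałaban's unit-scale
expectations on a finite torus — NOT the Yang–Mills mass gap, NOT the Clay problem.  Node O3c is a leaf of that spine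
(chain O3c → O3b → U5b → U5 → U6 → U0 → T): how much a unit-scale loop variable `W_C(avg^{n} V)` can change when the
level-`k` configuration `V` is changed on a region `Λ` (the rest fixed).  This module ASSERTS NOTHING about Bałaban's
averaging operations beyond the two axioms the tree's `Setup.Averaging` records (gauge covariance, local dependence):
`LoopOscBound` below is a HYPOTHESIS SHAPE (the cell's typing of estimate NE1a, which is NOT in print), consumed only as a
hypothesis, and every theorem is elementary (induction on the number of averaging steps).  Value = typed located
estimate + kernel bookkeeping of its structural half; NOT summit progress.

CITATION HEADER (lean-in-tree rule 2026-08-18).  Typed skeleton around T. Bałaban, *Averaging operations for lattice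
gauge theories*, Commun. Math. Phys. **98** (1985) 17–51 [Balaban1985Averaging] (cell paper B7; PDF page = journal
page − 16).  WHAT IS PRINTED and used here (verbatim, read by this seat on the renders
`b2b-balaban-ref1/pages/1985-cmp98-averaging/1985-cmp98-averaging-p002-x2.png`, `-p003-x2.png`):
* p. 19 [PDF 3], (11): "A first condition is connected with the fact that we consider gauge-invariant quantities, so we
  demand that the averaging preserves gauge transformations, i.e., (Ū^u)(y, y′) = u(y)Ū(y, y′)u^{−1}(y′), or Ū^u = (Ū)^u."
  (Tree: the axiom `Setup.Averaging.covariant`; iterated from the finest level in `T4Continuum.iter_gaugeAct`.)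
* p. 19 [PDF 3], (14)–(15): the linear averaging "Ā_c = Σ_{x∈B(c₋)} L^{−(d+1)}(A(Γ_{c₋,x}) + A([x, x(c)]) + A(Γ_{x(c),c₊}))"
  and the average "Ū_c = exp[i Σ_{x∈B(c₋)} L^{−d} (1/i) log U(Γ_{c,x})U(c)^{−1}] U(c)" — "Γ_{c₋,x} ∪ [x, x(c)] ∪ Γ_{x(c),c₊}
  is an oriented contour with c₋ as an initial point and c₊ as a final point. We denote it by Γ_{c,x}."  Quoted as the
  CONTEXT in which the sensitivity question is posed (the contour systems are NOT modelled in the tree, DIVERGENCE F6;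
  only the axiom `Setup.Averaging.local_dep` — `Ū_c` depends on `U` through the bonds of the two blocks `B(c₋)`, `B(c₊)` —
  is used below).
* p. 18 [PDF 2], (8): "U^u(x, x′) = u(x)U(x, x′)u^{−1}(x′)" (tree `GaugeField.gaugeAct`).
WHAT IS NOT PRINTED (cell T4-DAG v1 §2 O3c: "Status NEW (not printed: B7 Props 1–3 pp.22–33 are regularity statements
'small fine field ⇒ small coarse field', not sensitivities)"): any bound on the dependence of `W_C(avg^n V)` on a
localised change of `V`.  Hence `LoopOscBound` is a HYPOTHESIS.

THE NODE (T4-DAG v1 §2 O3c, verbatim): "For a unit loop C and a k-scale region Λ: osc over V_k⌈Λ (rest fixed, all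
fields in the domains where (0.4)–(0.12) are C¹) of W_C(avg^{K−k}V_k) ≤ C_W |Λ| θ_av^{K−k} for some θ_av < 1. CAUTION
(why 'gauge-invariant' is in the name): a single fine bond at the root of a block's contour system (B7 (8)–(10) p.18:
the contours Γ_{y,x}) moves the block variable by O(1) — but by an (almost exact) coarse GAUGE transformation at y,
invisible to W_C; the gauge-invariant residual is O(L^{−3})-small per level."  Consumer: node O3b (i),(ii) (the dressed
R-operation: `|D_i^{(k)}| ≤ Σ_C |μ_C| · osc_{Λ_i}(W_C ∘ avg^{K−k})`).

WHAT IS KERNEL-CHECKED.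
§1 VOCABULARY: `iterFrom av k n : GaugeField P k G → GaugeField P (k+n) G`, the `n`-fold averaging STARTING AT LEVEL k
   (`Setup.Averaging.iter` starts at level 0 only); `iter_add`: `iter av (k+n) = iterFrom av k n ∘ iter av k`.
§2 THE CAUTION MADE PRECISE — gauge perturbations are invisible at every later level: `transfUpFrom` (a level-k gauge
   transformation restricted up the levels along the block centres), `iterFrom_gaugeAct` ((11) iterated from level k, in
   the standing range k + n ≤ m + K of `Params`), `loopAt_iterFrom_gaugeAct`: for every closed walk,
   `loopAt (iterFrom av k n (V^u)) = loopAt (iterFrom av k n V)` — so the oscillation in NE1a is an oscillation over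
   gauge ORBITS, and the O(1) move of a block variable by a root contour bond contributes nothing.
§3 LOCALITY — perturbations propagate only along the block tower: `inflStep`/`infl` (the influence sets: a coarse site is
   influenced iff its block or a forward neighbour's block meets the influenced fine sites), `agreeOff_avg`,
   `iterFrom_agreeOff` (`Setup.Averaging.local_dep` iterated: V = V′ on all bonds with source outside S ⇒ avg^n V = avg^n V′
   on all bonds with source outside `infl S n`), `loopAt_iterFrom_eq_of_avoids` (a loop variable whose walk avoids the
   influence set does not feel the perturbation at all).
§4 NE1a TYPED: `LoopOscBound av dom C_W θ` — for all k, n in range, every closed walk (x, w) at level k + n, every finite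
   set Λ of level-k bonds and all V, V′ in the domain `dom k` agreeing off Λ:
   `|loopAt (iterFrom av k n V) (walk x w) − loopAt (iterFrom av k n V′) (walk x w)| ≤ C_W · |w| · |Λ| · θ^n`.
   CONSISTENCY / WHERE THE CONTENT IS: `loopOscBound_two_one` — the shape holds TRIVIALLY with (C_W, θ) = (2, 1) for any
   averaging and any domain (loop variables are bounded by 1); the whole content of NE1a is `θ < 1` (with C_W independent
   of k, n, Λ), which nothing here proves.  `LoopOscBound.mono` / `.anti`: monotone in (C_W, θ), antitone in `dom`.
§5 FIBREWISE FORM: `LoopOscBound.updateFinset` / `loopOscBound_of_updateFinset` — the same hypothesis phrased with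
   Mathlib's `Function.updateFinset` on a finite set of bonds, the fibre coordinates of `T4DressedR` (node O3b's carrier).
A heuristic derivation of θ_av (abelian linearised model of (14): a fine plaquette angle enters a coarse plaquette angle
with total weight L²·L^{−d} = L^{−2}; Stokes for W_C; non-abelian corrections O(ε) per level, θ_av ≈ max(L^{−2}, C ε)) and
WHY THE HYPOTHESIS MIGHT FAIL as typed are in the cell file `t4/T4-EST-O3c.md` (this unit); nothing of it is used here.

Deliberately NOT here: the contour systems and formulas (14)–(15) themselves (DIVERGENCE F6), B7 Props 1–3, any measure
theory.  Imports `T4Continuum` (walks, `loopAt`, `loopAt_gaugeAct_walk`); Mathlib otherwise; no `sorry`/`axiom`.  Unit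
`b2b-balaban-pv16` gen 3 (ACTING claim on row T4-O3c.E); records GAPS C-pv16-6 / G-pv16-3, `t4/T4-EST-O3c.md`.
-/

namespace Literature.MathematicalPhysics.QuantumFieldTheory.Balaban1983to89.T4AvgSensitivity

open Literature.MathematicalPhysics.QuantumFieldTheory.Balaban1983to89
open Literature.MathematicalPhysics.QuantumFieldTheory.Balaban1983to89.T4Continuum

variable {P : Params} {G : Type*} [GaugeGroup G]

/-! ## §1 Averaging from level `k` -/

/-- The `n`-fold iterate of a family of one-step averagings STARTING AT LEVEL `k`: `avg_{k+n−1} ∘ ⋯ ∘ avg_k`,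
`T^{(k)} → T^{(k+n)}` (the tree's `Setup.Averaging.iter` is the case `k = 0`, `iter_add`). [cite: Balaban1987RG1, (0.11) p.253] -/
def iterFrom (av : ∀ j, Averaging P j G) (k : ℕ) : (n : ℕ) → GaugeField P k G → GaugeField P (k + n) G
  | 0 => id
  | n + 1 => (av (k + n)).avg ∘ iterFrom av k n

/-- No step: the identity. [folklore] -/
@[simp] theorem iterFrom_zero (av : ∀ j, Averaging P j G) (k : ℕ) (V : GaugeField P k G) : iterFrom av k 0 V = V := rfl

/-- One more step: average once more. [folklore] -/
theorem iterFrom_succ (av : ∀ j, Averaging P j G) (k n : ℕ) (V : GaugeField P k G) :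
    iterFrom av k (n + 1) V = (av (k + n)).avg (iterFrom av k n V) := rfl

/-- `avg^{k+n}` from the finest level factors through level `k`: `iter av (k+n) U = iterFrom av k n (iter av k U)`. [folklore] -/
theorem iter_add (av : ∀ j, Averaging P j G) (k : ℕ) :
    ∀ (n : ℕ) (U : GaugeField P 0 G), Averaging.iter av (k + n) U = iterFrom av k n (Averaging.iter av k U)
  | 0, _ => rfl
  | n + 1, U => by
    show (av (k + n)).avg (Averaging.iter av (k + n) U) = (av (k + n)).avg (iterFrom av k n (Averaging.iter av k U))
    rw [iter_add av k n U]

/-! ## §2 The CAUTION made precise: gauge perturbations are invisible at every later level -/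

/-- A gauge transformation of `T^{(k)}` RESTRICTED UP THE LEVELS along the block centres: `u^{(0)} = u`,
`u^{(n+1)}(y) = u^{(n)}(emb y)` (as `T4Continuum.transfUp`, from level `k`). [cite: Balaban1985Averaging, (11) p.19] -/
def transfUpFrom {k : ℕ} (u : GaugeTransf P k G) : (n : ℕ) → GaugeTransf P (k + n) G
  | 0 => u
  | n + 1 => fun y => transfUpFrom u n (emb y)

/-- ITERATED AVERAGING FROM LEVEL `k` IS GAUGE COVARIANT: `avg^n(V^u) = (avg^n V)^{u^{(n)}}` in the standing range
`k + n ≤ m + K` — [Balaban1985Averaging] (11) "we demand that the averaging preserves gauge transformations, i.e.,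
Ū^u = (Ū)^u", iterated (tree axiom `Setup.Averaging.covariant`). [cite: Balaban1985Averaging, (11) p.19] -/
theorem iterFrom_gaugeAct (av : ∀ j, Averaging P j G) {k : ℕ} (u : GaugeTransf P k G) :
    ∀ (n : ℕ), k + n ≤ P.m + P.K → ∀ V : GaugeField P k G,
      iterFrom av k n (GaugeField.gaugeAct u V) = GaugeField.gaugeAct (transfUpFrom u n) (iterFrom av k n V)
  | 0, _, _ => rfl
  | n + 1, hn, V => by
    show (av (k + n)).avg (iterFrom av k n (GaugeField.gaugeAct u V)) =
      GaugeField.gaugeAct (fun y => transfUpFrom u n (emb y)) ((av (k + n)).avg (iterFrom av k n V))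
    rw [iterFrom_gaugeAct av u n (by omega) V, (av (k + n)).covariant hn]

/-- **GAUGE PERTURBATIONS ARE INVISIBLE** (the node's CAUTION): for every closed walk at level `k + n`, the loop variable
of the `n`-fold average does not distinguish `V` from `V^u` — so the oscillation in NE1a is over gauge orbits, and the
O(1) move of a block variable by a root contour bond (a coarse gauge transformation) contributes nothing.
[cite: Balaban1985Averaging, (12) p.19] -/
theorem loopAt_iterFrom_gaugeAct (av : ∀ j, Averaging P j G) {k : ℕ} (u : GaugeTransf P k G) (n : ℕ)
    (hn : k + n ≤ P.m + P.K) (V : GaugeField P k G) (x : Site P (k + n)) (w : List (Letter P.d))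
    (hw : walkEnd x w = x) :
    loopAt (iterFrom av k n (GaugeField.gaugeAct u V)) (walk x w) = loopAt (iterFrom av k n V) (walk x w) := by
  rw [iterFrom_gaugeAct av u n hn V]
  exact loopAt_gaugeAct_walk _ _ _ _ hw

/-! ## §3 Locality: perturbations propagate only along the block tower -/

/-- Two configurations AGREE OFF a set `S` of sites: they coincide on every bond whose source lies outside `S`. [folklore] -/
def AgreeOff {j : ℕ} (S : Set (Site P j)) (U U' : GaugeField P j G) : Prop := ∀ b : PBond P j, b.src ∉ S → U b = U' b

/-- One-step INFLUENCE SET of a set `S` of fine sites: the coarse sites `y` whose block, or whose forward neighbour's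
block `B(y + e_μ)`, meets `S` (by `Setup.Averaging.local_dep`, `Ū_c` depends on the bonds of `B(c₋)` and `B(c₊)` only).
[cite: Balaban1985Averaging, (15) p.19] -/
def inflStep {j : ℕ} (S : Set (Site P j)) : Set (Site P (j + 1)) :=
  {y | ∃ x ∈ S, blockOf x = y ∨ ∃ μ : Fin P.d, blockOf x = y.shift μ}

/-- The `n`-step influence set, up the block tower. [folklore] -/
def infl {k : ℕ} (S : Set (Site P k)) : (n : ℕ) → Set (Site P (k + n))
  | 0 => S
  | n + 1 => inflStep (infl S n)

/-- ONE STEP OF LOCALITY: configurations agreeing off `S` have averages agreeing off `inflStep S` (standing range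
`j + 1 ≤ m + K`; tree axiom `Setup.Averaging.local_dep`). [cite: Balaban1985Averaging, (15) p.19] -/
theorem agreeOff_avg {j : ℕ} (av : Averaging P j G) (hj : j + 1 ≤ P.m + P.K) {S : Set (Site P j)} {U U' : GaugeField P j G}
    (h : AgreeOff S U U') : AgreeOff (inflStep S) (av.avg U) (av.avg U') := by
  intro c hc
  refine av.local_dep hj U U' c fun b hb => h b fun hbS => hc ?_
  rcases hb with hb | hb
  · exact ⟨b.src, hbS, Or.inl hb⟩
  · exact ⟨b.src, hbS, Or.inr ⟨c.dir, hb⟩⟩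

/-- LOCALITY UP THE LEVELS: `V = V′` off `S` ⇒ `avg^n V = avg^n V′` off `infl S n` (standing range `k + n ≤ m + K`). [folklore] -/
theorem iterFrom_agreeOff (av : ∀ j, Averaging P j G) {k : ℕ} {S : Set (Site P k)} {V V' : GaugeField P k G}
    (h : AgreeOff S V V') : ∀ (n : ℕ), k + n ≤ P.m + P.K → AgreeOff (infl S n) (iterFrom av k n V) (iterFrom av k n V')
  | 0, _ => h
  | n + 1, hn => agreeOff_avg (av (k + n)) hn (iterFrom_agreeOff av h n (by omega))

/-- Holonomies along a walk depend only on the bonds it traverses. [folklore] -/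
theorem holAt_congr {j : ℕ} {U U' : GaugeField P j G} {γ : List (LStep P j)} (h : ∀ s ∈ γ, U s.bond = U' s.bond) :
    holAt U γ = holAt U' γ := by
  unfold holAt
  congr 1
  exact List.map_congr_left fun s hs => by rw [h s hs]

/-- A loop variable whose walk AVOIDS the influence set does not feel the perturbation: if `V = V′` off `S` and every bond
of the walk has its source outside `infl S n`, the two `n`-fold averages have the same loop variable. [folklore] -/
theorem loopAt_iterFrom_eq_of_avoids (av : ∀ j, Averaging P j G) {k : ℕ} {S : Set (Site P k)} {V V' : GaugeField P k G}
    (h : AgreeOff S V V') (n : ℕ) (hn : k + n ≤ P.m + P.K) (γ : List (LStep P (k + n)))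
    (hγ : ∀ s ∈ γ, s.bond.src ∉ infl S n) :
    loopAt (iterFrom av k n V) γ = loopAt (iterFrom av k n V') γ := by
  unfold loopAt
  rw [holAt_congr fun s hs => iterFrom_agreeOff av h n hn s.bond (hγ s hs)]

/-! ## §4 NE1a typed: the gauge-invariant sensitivity of iterated averaging (hypothesis shape) -/

/-- HYPOTHESIS SHAPE — NE1a, GAUGE-INVARIANT SENSITIVITY OF ITERATED AVERAGING (cell T4-DAG v1 §2 O3c / §6 NE1a): for
all levels `k` and step counts `n` in the standing range, every CLOSED walk `(x, w)` of `T^{(k+n)}`, every finite set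
`Λ` of level-`k` bonds and all configurations `V, V′` in the domain `dom k` (the set where the averaging formulas are C¹:
small plaquette variables, cell NOTATION; abstract here) which coincide off `Λ`:
`|W(avg^n V) − W(avg^n V′)| ≤ C_W · |w| · |Λ| · θ^n`, `W = loopAt · (walk x w)`.  The node text's "osc over V_k⌈Λ, rest
fixed, ≤ C_W|Λ|θ_av^{K−k}" with the loop's length made explicit.  NOT PRINTED ([Balaban1985Averaging] Props 1–3 are
regularity statements); consumed only as a hypothesis (node O3b).  By `loopAt_iterFrom_gaugeAct` the left side is an
oscillation over gauge orbits; by `loopOscBound_two_one` the shape holds trivially with `(C_W, θ) = (2, 1)`, so its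
content is exactly `θ < 1`. [cite: Balaban1985Averaging, (11) p.19] -/
def LoopOscBound (av : ∀ j, Averaging P j G) (dom : ∀ j, Set (GaugeField P j G)) (C_W θ : ℝ) : Prop :=
  ∀ (k n : ℕ), k + n ≤ P.m + P.K → ∀ (x : Site P (k + n)) (w : List (Letter P.d)), walkEnd x w = x →
    ∀ (Λ : Finset (PBond P k)) (V V' : GaugeField P k G), V ∈ dom k → V' ∈ dom k → (∀ b, b ∉ Λ → V b = V' b) →
      |loopAt (iterFrom av k n V) (walk x w) - loopAt (iterFrom av k n V') (walk x w)|
        ≤ C_W * (w.length : ℝ) * (Λ.card : ℝ) * θ ^ n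

/-- The sensitivity hypothesis is monotone in its constants (for a non-negative target constant). [folklore] -/
theorem LoopOscBound.mono {av : ∀ j, Averaging P j G} {dom : ∀ j, Set (GaugeField P j G)} {C_W C_W' θ θ' : ℝ}
    (h : LoopOscBound av dom C_W θ) (hC : C_W ≤ C_W') (hC' : 0 ≤ C_W') (hθ0 : 0 ≤ θ) (hθ : θ ≤ θ') :
    LoopOscBound av dom C_W' θ' := by
  intro k n hn x w hw Λ V V' hV hV' hΛ
  refine (h k n hn x w hw Λ V V' hV hV' hΛ).trans ?_
  calc C_W * (w.length : ℝ) * (Λ.card : ℝ) * θ ^ n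
      ≤ C_W' * (w.length : ℝ) * (Λ.card : ℝ) * θ ^ n :=
        mul_le_mul_of_nonneg_right (mul_le_mul_of_nonneg_right
          (mul_le_mul_of_nonneg_right hC (Nat.cast_nonneg _)) (Nat.cast_nonneg _)) (pow_nonneg hθ0 n)
    _ ≤ C_W' * (w.length : ℝ) * (Λ.card : ℝ) * θ' ^ n :=
        mul_le_mul_of_nonneg_left (pow_le_pow_left₀ hθ0 hθ n)
          (mul_nonneg (mul_nonneg hC' (Nat.cast_nonneg _)) (Nat.cast_nonneg _))

/-- Restricting the domains preserves the hypothesis. [folklore] -/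
theorem LoopOscBound.anti {av : ∀ j, Averaging P j G} {dom dom' : ∀ j, Set (GaugeField P j G)} {C_W θ : ℝ}
    (h : LoopOscBound av dom C_W θ) (hd : ∀ j, dom' j ⊆ dom j) : LoopOscBound av dom' C_W θ :=
  fun k n hn x w hw Λ V V' hV hV' hΛ => h k n hn x w hw Λ V V' (hd k hV) (hd k hV') hΛ

/-- CONSISTENCY, AND WHERE THE CONTENT IS: the shape `LoopOscBound` holds TRIVIALLY with `(C_W, θ) = (2, 1)` for every
family of averagings and every domain, because loop variables are bounded by `1` (and the two sides coincide when the
word or the perturbed set is empty).  So the entire content of NE1a is a rate `θ < 1` with `C_W` uniform in `k, n, Λ` —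
which nothing in this module (or in print) provides. [folklore] -/
theorem loopOscBound_two_one [MeasurableSpace G] [RegularGaugeGroup G] (av : ∀ j, Averaging P j G)
    (dom : ∀ j, Set (GaugeField P j G)) : LoopOscBound av dom 2 1 := by
  intro k n hn x w hw Λ V V' hV hV' hΛ
  rw [one_pow, mul_one]
  by_cases hΛ0 : Λ = ∅
  · subst hΛ0
    have hVV : V = V' := funext fun b => hΛ b (Finset.notMem_empty b)
    subst hVV
    rw [sub_self, abs_zero]
    positivity
  by_cases hw0 : w = []
  · subst hw0
    show |loopAt (iterFrom av k n V) [] - loopAt (iterFrom av k n V') []| ≤ _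
    rw [loopAt, loopAt, holAt_nil, holAt_nil, sub_self, abs_zero]
    positivity
  have h1 : (1 : ℝ) ≤ (w.length : ℝ) := by
    exact_mod_cast Nat.one_le_iff_ne_zero.mpr fun h0 => hw0 (List.eq_nil_of_length_eq_zero h0)
  have h2 : (1 : ℝ) ≤ (Λ.card : ℝ) := by
    exact_mod_cast Finset.one_le_card.mpr (Finset.nonempty_iff_ne_empty.mpr hΛ0)
  calc |loopAt (iterFrom av k n V) (walk x w) - loopAt (iterFrom av k n V') (walk x w)|
      ≤ |loopAt (iterFrom av k n V) (walk x w)| + |loopAt (iterFrom av k n V') (walk x w)| := abs_sub _ _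
    _ ≤ 1 + 1 := add_le_add (abs_loopAt_le_one _ _) (abs_loopAt_le_one _ _)
    _ = 2 * 1 * 1 := by norm_num
    _ ≤ 2 * (w.length : ℝ) * (Λ.card : ℝ) := by gcongr

/-! ## §5 Fibrewise form (the interface to the dressed R-operation, whose fibres are finite sets of bonds) -/

omit [GaugeGroup G] in
/-- A configuration agreeing with `V` off `Λ` IS `V` updated on `Λ` (Mathlib `Function.updateFinset`, the fibre
coordinates of `T4DressedR` / `B15.BasicStep`). [folklore] -/
theorem eq_updateFinset_of_agreeOff {k : ℕ} [DecidableEq (PBond P k)] {Λ : Finset (PBond P k)} {V V' : GaugeField P k G}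
    (h : ∀ b, b ∉ Λ → V b = V' b) : V' = Function.updateFinset V Λ (fun b => V' b) := by
  funext b
  by_cases hb : b ∈ Λ
  · simp only [Function.updateFinset, dif_pos hb]
  · simp only [Function.updateFinset, dif_neg hb, h b hb]

/-- FIBREWISE SENSITIVITY: under `LoopOscBound`, replacing the variables of `V` on the fibre `Λ` (both configurations in
the domain) moves the level-`(k+n)` loop variable by at most `C_W·|w|·|Λ|·θ^n` — the form in which node O3b consumes NE1a
(oscillation of the dressing `exp(λ·W∘avg^{K−k})` over the integrated variables `V_k⌈Λ_i`, rest fixed). [folklore] -/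
theorem LoopOscBound.updateFinset {av : ∀ j, Averaging P j G} {dom : ∀ j, Set (GaugeField P j G)} {C_W θ : ℝ}
    (h : LoopOscBound av dom C_W θ) {k : ℕ} [DecidableEq (PBond P k)] (n : ℕ) (hn : k + n ≤ P.m + P.K)
    (x : Site P (k + n)) (w : List (Letter P.d)) (hw : walkEnd x w = x) (Λ : Finset (PBond P k))
    (V : GaugeField P k G) (y : Λ → G) (hV : V ∈ dom k) (hV' : Function.updateFinset V Λ y ∈ dom k) :
    |loopAt (iterFrom av k n V) (walk x w) - loopAt (iterFrom av k n (Function.updateFinset V Λ y)) (walk x w)|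
      ≤ C_W * (w.length : ℝ) * (Λ.card : ℝ) * θ ^ n :=
  h k n hn x w hw Λ V _ hV hV' fun b hb => by simp only [Function.updateFinset, dif_neg hb]

/-- Conversely the fibrewise form gives back the oscillation form: the two are the same hypothesis. [folklore] -/
theorem loopOscBound_of_updateFinset {av : ∀ j, Averaging P j G} {dom : ∀ j, Set (GaugeField P j G)} {C_W θ : ℝ}
    [∀ k, DecidableEq (PBond P k)]
    (h : ∀ (k n : ℕ), k + n ≤ P.m + P.K → ∀ (x : Site P (k + n)) (w : List (Letter P.d)), walkEnd x w = x →
      ∀ (Λ : Finset (PBond P k)) (V : GaugeField P k G) (y : Λ → G), V ∈ dom k → Function.updateFinset V Λ y ∈ dom k →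
        |loopAt (iterFrom av k n V) (walk x w) - loopAt (iterFrom av k n (Function.updateFinset V Λ y)) (walk x w)|
          ≤ C_W * (w.length : ℝ) * (Λ.card : ℝ) * θ ^ n) :
    LoopOscBound av dom C_W θ := by
  intro k n hn x w hw Λ V V' hV hV' hΛ
  have hV'eq := eq_updateFinset_of_agreeOff (G := G) hΛ
  rw [hV'eq] at hV' ⊢
  exact h k n hn x w hw Λ V _ hV hV'

end Literature.MathematicalPhysics.QuantumFieldTheory.Balaban1983to89.T4AvgSensitivity
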